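import Mathlib
import HarnessLib

/-!
# Lattice-dominated root counts bound the zero functional `Σ_ρ ‖1 − ρ‖⁻²` (crux stmt-Parity-11291, line
`buchstab-flow-hyperbolicity`, joint `LatticeSum`)

Everything here is PROVED (theorems only, no definitions).  For a complex polynomial `P`, if no root lies within
`r₀ ∈ (0,1]` of `1` and for every `m : ℕ` at most `k·m + C₀` roots satisfy `‖1 − ρ‖ < m + 1` (the count profile of
`k` copies of the lattice `0, −1, −2, …` seen from `1`, up to `C₀` exceptions), then
`Σ_ρ ‖1 − ρ‖⁻² ≤ C₀/r₀² + k·π²/6` (`latticeSum`).  Proof: annulus majorant `d⁻² ≤ w ⌊d⌋₊` with the antitone weights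
`w 0 = r₀⁻²`, `w m = m⁻² (m ≥ 1)`, the weighted-count identity (induction on the multiset of distances), discrete Abel
summation against the cumulative counts, and `Σ_{j ≥ 1} j⁻² = π²/6` (`hasSum_zeta_two`).  The Abel-summation lemmas are
stated for an arbitrary weight sequence `w : ℕ → ℝ`.  This is the planner's in-skeleton proof
(`Cruxes/SystemZeroRepulsion/Lines/buchstab-flow-hyperbolicity.lean` §4, `latticeSum_holds`) made import-able; it is the
joint through which a lattice count of the rough polynomial would bound its share of the crux functional.
-/

open scoped BigOperators

namespace Summit.Parity.BatemanHorn.Cruxes.SystemZeroRepulsion.BuchstabFlowHyperbolicity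

/-- Telescoping against an indicator: `Σ_{j < M} [a ≤ j]·(w j − w (j+1)) = w a − w M` for `a ≤ M`. -/
theorem sum_indicator_sub_telescope (w : ℕ → ℝ) {a M : ℕ} (haM : a ≤ M) :
    ∑ j ∈ Finset.range M, (if a ≤ j then w j - w (j + 1) else 0) = w a - w M := by
  induction M with
  | zero =>
    have : a = 0 := Nat.le_zero.mp haM
    subst this; simp
  | succ M ih =>
    rcases Nat.eq_or_lt_of_le haM with h | h
    · subst h
      rw [Finset.sum_eq_zero]
      · ring
      intro j hj
      have := Finset.mem_range.mp hj
      rw [if_neg (by omega)]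
    · rw [Finset.sum_range_succ, ih (by omega), if_pos (by omega)]
      ring

/-- Discrete Abel identity behind the bound: for `M ≥ 1`,
`Σ_{j<M} (w j − w (j+1))·(k j + C₀) + w M·(k (M−1) + C₀) = C₀·w 0 + k·Σ_{j ∈ [1,M)} w j`. -/
theorem abel_weight_identity (w : ℕ → ℝ) (k C₀ : ℝ) (M : ℕ) (hM : 1 ≤ M) :
    ∑ j ∈ Finset.range M, (w j - w (j + 1)) * (k * j + C₀) + w M * (k * ((M : ℝ) - 1) + C₀)
      = C₀ * w 0 + k * ∑ j ∈ Finset.Ico 1 M, w j := by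
  induction M, hM using Nat.le_induction with
  | base =>
    simp only [Finset.sum_range_one, Finset.Ico_self, Finset.sum_empty, Nat.cast_zero, Nat.cast_one,
      mul_zero, zero_add, sub_self, add_zero]
    ring
  | succ M hM ih =>
    rw [Finset.sum_range_succ, Finset.sum_Ico_succ_top hM]
    push_cast
    linear_combination ih

/-- The weighted-count identity (induction on the multiset): for `D` with all `0 ≤ d` and `⌊d⌋₊ < M`,
`Σ_{d ∈ D} w ⌊d⌋₊ = Σ_{j<M} (w j − w (j+1))·#{d ∈ D : d < j+1} + w M·|D|`. -/
theorem sum_weight_floor_eq (w : ℕ → ℝ) (M : ℕ) (D : Multiset ℝ) (hD : ∀ d ∈ D, 0 ≤ d ∧ ⌊d⌋₊ < M) :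
    (D.map fun d => w ⌊d⌋₊).sum
      = ∑ j ∈ Finset.range M, (w j - w (j + 1)) * ((D.filter fun d => d < (j : ℝ) + 1).card : ℝ)
        + w M * (D.card : ℝ) := by
  induction D using Multiset.induction_on with
  | empty => simp
  | cons a D ih =>
    have ha := hD a (Multiset.mem_cons_self a D)
    have hD' : ∀ d ∈ D, 0 ≤ d ∧ ⌊d⌋₊ < M := fun d hd => hD d (Multiset.mem_cons_of_mem hd)
    have hfilt : ∀ j : ℕ, ((Multiset.filter (fun d => d < (j : ℝ) + 1) (a ::ₘ D)).card : ℝ)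
        = ((Multiset.filter (fun d => d < (j : ℝ) + 1) D).card : ℝ) + (if ⌊a⌋₊ ≤ j then 1 else 0) := by
      intro j
      by_cases h : a < (j : ℝ) + 1
      · rw [Multiset.filter_cons_of_pos (p := fun d => d < (j : ℝ) + 1) D h, Multiset.card_cons]
        have hle : ⌊a⌋₊ ≤ j := by
          have h2 : a < ((j + 1 : ℕ) : ℝ) := by exact_mod_cast h
          have h3 : ⌊a⌋₊ < j + 1 := (Nat.floor_lt ha.1).mpr h2
          omega
        rw [if_pos hle]
        push_cast
        ring
      · rw [Multiset.filter_cons_of_neg (p := fun d => d < (j : ℝ) + 1) D h]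
        have hnot : ¬ ⌊a⌋₊ ≤ j := by
          intro hle
          apply h
          have h3 : a < ((j + 1 : ℕ) : ℝ) := (Nat.floor_lt ha.1).mp (by omega)
          exact_mod_cast h3
        rw [if_neg hnot]
        ring
    have htel : ∑ j ∈ Finset.range M, (w j - w (j + 1)) * (if ⌊a⌋₊ ≤ j then (1 : ℝ) else 0)
        = w ⌊a⌋₊ - w M := by
      rw [← sum_indicator_sub_telescope w ha.2.le]
      refine Finset.sum_congr rfl fun j _ => ?_
      split_ifs <;> simp
    rw [Multiset.map_cons, Multiset.sum_cons, ih hD', Multiset.card_cons]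
    simp_rw [hfilt, mul_add]
    rw [Finset.sum_add_distrib, htel]
    push_cast
    ring

/-- **`LatticeSum`: lattice domination bounds the zero functional.**  For a complex polynomial `P`, `0 < r₀ ≤ 1`,
no root within `r₀` of `1`, and at most `k·m + C₀` roots with `‖1 − ρ‖ < m + 1` for every `m : ℕ`:
`Σ_ρ ‖1 − ρ‖⁻² ≤ C₀/r₀² + k·π²/6` (roots with multiplicity).  Annulus majorant `d⁻² ≤ w ⌊d⌋₊` for the antitone
weights `w 0 = r₀⁻²`, `w (m+1) = (m+1)⁻²` (`r₀ ≤ 1` makes `w 1 ≤ w 0`), the weighted-count identity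
`sum_weight_floor_eq`, Abel summation `abel_weight_identity` against the counts, and `hasSum_zeta_two`. -/
theorem latticeSum : ∀ (k C₀ : ℕ) (r₀ : ℝ) (P : Polynomial ℂ), 0 < r₀ → r₀ ≤ 1 →
    (∀ ρ ∈ P.roots, r₀ ≤ ‖(1 : ℂ) - ρ‖) →
    (∀ m : ℕ, (P.roots.filter fun ρ : ℂ => ‖(1 : ℂ) - ρ‖ < (m : ℝ) + 1).card ≤ k * m + C₀) →
    (P.roots.map fun ρ : ℂ => (‖(1 : ℂ) - ρ‖ ^ 2)⁻¹).sum ≤ (C₀ : ℝ) / r₀ ^ 2 + (k : ℝ) * (Real.pi ^ 2 / 6) := by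
  intro k C₀ r₀ P hr₀ hr₁ hfar hcount
  -- the weights
  set w : ℕ → ℝ := fun m => if m = 0 then (r₀ ^ 2)⁻¹ else ((m : ℝ) ^ 2)⁻¹ with hwdef
  have hw0 : w 0 = (r₀ ^ 2)⁻¹ := by simp [hwdef]
  have hwsucc : ∀ m : ℕ, w (m + 1) = (((m : ℝ) + 1) ^ 2)⁻¹ := fun m => by simp [hwdef]
  have hwnn : ∀ m, 0 ≤ w m := fun m => by rcases m with _ | m <;> simp [hwdef] <;> positivity
  have hwanti : ∀ m, w (m + 1) ≤ w m := by
    intro m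
    rcases m with _ | m
    · rw [hwsucc, hw0]
      have h1 : r₀ ^ 2 ≤ 1 := pow_le_one₀ hr₀.le hr₁
      calc ((((0 : ℕ) : ℝ) + 1) ^ 2)⁻¹ = 1 := by norm_num
        _ ≤ (r₀ ^ 2)⁻¹ := (one_le_inv₀ (by positivity)).mpr h1
    · rw [hwsucc, hwsucc]
      apply inv_anti₀ (by positivity)
      push_cast
      nlinarith [(Nat.cast_nonneg m : (0 : ℝ) ≤ m)]
  -- annulus majorant
  have hmaj : ∀ d : ℝ, r₀ ≤ d → (d ^ 2)⁻¹ ≤ w ⌊d⌋₊ := by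
    intro d hd
    have hd0 : 0 < d := lt_of_lt_of_le hr₀ hd
    rcases Nat.eq_zero_or_pos ⌊d⌋₊ with h0 | hpos
    · rw [h0, hw0]
      exact inv_anti₀ (by positivity) (by gcongr)
    · obtain ⟨m, hm⟩ : ∃ m, ⌊d⌋₊ = m + 1 := Nat.exists_eq_succ_of_ne_zero (by omega)
      rw [hm, hwsucc]
      apply inv_anti₀ (by positivity)
      have hle : ((m : ℝ) + 1) ≤ d := by
        have h := Nat.floor_le hd0.le
        rw [hm] at h
        push_cast at h
        exact h
      have hm0 : (0 : ℝ) ≤ (m : ℝ) + 1 := by positivity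
      gcongr
  -- the multiset of distances
  set D : Multiset ℝ := P.roots.map (fun ρ : ℂ => ‖(1 : ℂ) - ρ‖) with hDdef
  have hDmem : ∀ d ∈ D, r₀ ≤ d := by
    intro d hd
    obtain ⟨ρ, hρ, rfl⟩ := Multiset.mem_map.mp hd
    exact hfar ρ hρ
  have hDcount : ∀ m : ℕ, ((D.filter fun d => d < (m : ℝ) + 1).card : ℝ) ≤ k * m + C₀ := by
    intro m
    have e : (D.filter fun d => d < (m : ℝ) + 1).card
        = (P.roots.filter fun ρ : ℂ => ‖(1 : ℂ) - ρ‖ < (m : ℝ) + 1).card := by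
      rw [hDdef, ← Multiset.countP_eq_card_filter, Multiset.countP_map]
    rw [e]
    exact_mod_cast hcount m
  have hT : (P.roots.map fun ρ : ℂ => (‖(1 : ℂ) - ρ‖ ^ 2)⁻¹).sum = (D.map fun d => (d ^ 2)⁻¹).sum := by
    rw [hDdef, Multiset.map_map]
    rfl
  -- Step A: annulus majorant
  have hA : (D.map fun d => (d ^ 2)⁻¹).sum ≤ (D.map fun d => w ⌊d⌋₊).sum :=
    Multiset.sum_map_le_sum_map _ _ fun d hd => hmaj d (hDmem d hd)
  -- Step B: the identity at a level M above every annulus index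
  set M : ℕ := (D.map fun d => ⌊d⌋₊).sup + 1 with hMdef
  have hDM : ∀ d ∈ D, 0 ≤ d ∧ ⌊d⌋₊ < M := by
    intro d hd
    refine ⟨hr₀.le.trans (hDmem d hd), ?_⟩
    have : ⌊d⌋₊ ≤ (D.map fun d => ⌊d⌋₊).sup := Multiset.le_sup (Multiset.mem_map_of_mem _ hd)
    omega
  have hB := sum_weight_floor_eq w M D hDM
  have hM1 : 1 ≤ M := by omega
  have hcardD : (D.card : ℝ) ≤ k * ((M : ℝ) - 1) + C₀ := by
    have hfilt : (D.filter fun d => d < ((M - 1 : ℕ) : ℝ) + 1) = D := by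
      apply Multiset.filter_eq_self.mpr
      intro d hd
      have h1 := (hDM d hd).2
      have h2 : d < (⌊d⌋₊ : ℝ) + 1 := Nat.lt_floor_add_one d
      have h3 : (⌊d⌋₊ : ℝ) ≤ ((M - 1 : ℕ) : ℝ) := by
        have : ⌊d⌋₊ ≤ M - 1 := by omega
        exact_mod_cast this
      linarith
    have h := hDcount (M - 1)
    rw [hfilt] at h
    have e : ((M - 1 : ℕ) : ℝ) = (M : ℝ) - 1 := by
      rw [Nat.cast_sub hM1]
      simp
    rw [e] at h
    exact h
  -- Step C: Abel summation against the cumulative counts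
  have hΔ : ∀ j, 0 ≤ w j - w (j + 1) := fun j => sub_nonneg.mpr (hwanti j)
  have hC : ∑ j ∈ Finset.range M, (w j - w (j + 1)) * ((D.filter fun d => d < (j : ℝ) + 1).card : ℝ)
        + w M * (D.card : ℝ)
      ≤ ∑ j ∈ Finset.range M, (w j - w (j + 1)) * (k * j + C₀) + w M * (k * ((M : ℝ) - 1) + C₀) :=
    add_le_add (Finset.sum_le_sum fun j _ => mul_le_mul_of_nonneg_left (hDcount j) (hΔ j))
      (mul_le_mul_of_nonneg_left hcardD (hwnn M))
  rw [abel_weight_identity w k C₀ M hM1] at hC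
  -- Step D: ζ(2)
  have hZ : ∑ j ∈ Finset.Ico 1 M, w j ≤ Real.pi ^ 2 / 6 := by
    have hs : ∑ j ∈ Finset.Ico 1 M, w j = ∑ j ∈ Finset.Ico 1 M, 1 / (j : ℝ) ^ 2 := by
      refine Finset.sum_congr rfl fun j hj => ?_
      have hj1 : 1 ≤ j := (Finset.mem_Ico.mp hj).1
      have : j ≠ 0 := by omega
      simp [hwdef, this, one_div]
    rw [hs]
    exact sum_le_hasSum _ (fun j _ => by positivity) hasSum_zeta_two
  have hk : (0 : ℝ) ≤ (k : ℝ) := by positivity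
  calc (P.roots.map fun ρ : ℂ => (‖(1 : ℂ) - ρ‖ ^ 2)⁻¹).sum = (D.map fun d => (d ^ 2)⁻¹).sum := hT
    _ ≤ (D.map fun d => w ⌊d⌋₊).sum := hA
    _ = _ := hB
    _ ≤ C₀ * w 0 + k * ∑ j ∈ Finset.Ico 1 M, w j := hC
    _ ≤ C₀ * (r₀ ^ 2)⁻¹ + k * (Real.pi ^ 2 / 6) := by
        rw [hw0]
        nlinarith [mul_le_mul_of_nonneg_left hZ hk, (Nat.cast_nonneg C₀ : (0:ℝ) ≤ C₀),
          inv_nonneg.mpr (sq_nonneg r₀)]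
    _ = (C₀ : ℝ) / r₀ ^ 2 + (k : ℝ) * (Real.pi ^ 2 / 6) := by ring

end Summit.Parity.BatemanHorn.Cruxes.SystemZeroRepulsion.BuchstabFlowHyperbolicity
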